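import Summits.AtomisticToContinuum.Crystallization.Theorems.GappedShellCensusRadialDefectsVanishSplit

/-!
# `GappedShellCensus.RadialDefectsVanish` (stmt-AtomisticToContinuum-15930) split glue — the locality radius is free

Companion of `GappedShellCensusRadialDefectsVanishSplit.lean` (line `Sketch` rev 3, lead c2).  The crux-strategist's census
(Cruxes/RadialDefectsVanish/STRATEGY-CENSUS.md, D5) records that the radius `7/2` in the third child `GapBeyondTwelve` "is not
load-bearing (any `R ≥ 0` serves the glue)".  So that the planners can file that child at whatever locality radius its own
line wants — larger `R` is a WEAKER child (fewer sites count as locally twelve), `R = 0` the strongest the glue accepts —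
without re-landing glue, this file repeats the packing count and the glue with a general `R ≥ 0` (proofs verbatim from the
landed file, `7/2 ↦ R`), and composes with the landed `RdvSplit.stub_thickThirteen_of_tammes`:

* `RdvSplitRadius.card_le_mul_card_of_local_at` — `#SL ≤ (2R/δ + 1)³ · #SB`;
* `RadialDefectsVanish_of_subs_at` — `TwelveWithinOne → ThickThirteen → GapBeyondTwelveAt R → RadialDefectsVanish`;
* `radialDefectsVanish_of_tammes_at`, `radialDefectsVanish_of_tammes_at_zero` — the same from the Tammes-13 named fact.

All hypotheses are stated literally (no definitions introduced).
-/

noncomputable section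

open scoped BigOperators Topology Classical RealInnerProductSpace
open Filter Finset
open Literature.MathematicalPhysics.StatisticalMechanics
open Literature.Geometry.DiscreteGeometry (musinTarasov2012_tammes_thirteen)

namespace Summit.AtomisticToContinuum.Crystallization.Theorems

namespace RdvSplitRadius

variable {N : ℕ}

/-- **Packing count of the spoiled sites, general locality radius `R ≥ 0`** (as `RdvSplit.card_le_mul_card_of_local`,
the case `R = 7/2`): in a `δ`-separated configuration, if every site of `SL` has, within distance `R`, a site
violating `G`, and `SB` contains every site violating `G`, then `#SL ≤ (2R/δ + 1)³ · #SB`. [folklore] -/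
theorem card_le_mul_card_of_local_at {R : ℝ} (hR : 0 ≤ R) (X : Fin N → EuclideanSpace ℝ (Fin 3)) (G : Fin N → Prop) {δ : ℝ} (hδ : 0 < δ)
    (hsep : ∀ i j : Fin N, i ≠ j → δ ≤ dist (X i) (X j)) (SL SB : Finset (Fin N))
    (hSL : ∀ i ∈ SL, ¬ ∀ j : Fin N, dist (X i) (X j) ≤ R → G j) (hSB : ∀ j : Fin N, ¬ G j → j ∈ SB) :
    (SL.card : ℝ) ≤ (2 * (R) / δ + 1) ^ 3 * SB.card := by
  set ball : Fin N → Finset (Fin N) := fun j =>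
    Finset.univ.filter fun i : Fin N => dist (X i) (X j) ≤ R with hball
  have hsub : SL ⊆ SB.biUnion ball := by
    intro i hi
    have h := hSL i hi
    push Not at h
    obtain ⟨j, hj, hg⟩ := h
    refine Finset.mem_biUnion.2 ⟨j, hSB j hg, ?_⟩
    simp only [hball, Finset.mem_filter, Finset.mem_univ, true_and]
    exact hj
  have hinj : Function.Injective X := by
    intro a b hab
    by_contra hne
    have := hsep a b hne
    rw [hab, dist_self] at this
    linarith
  have hballcard : ∀ j : Fin N, ((ball j).card : ℝ) ≤ (2 * (R) / δ + 1) ^ 3 := by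
    intro j
    have hc : ((ball j).image X).card = (ball j).card := Finset.card_image_of_injective _ hinj
    have h := card_le_of_separated_of_dist_le ((ball j).image X) (X j) hδ
      hR ?_ ?_
    · rw [hc, finrank_euclideanSpace_fin] at h
      exact h
    · intro c hc'
      obtain ⟨i, hi, rfl⟩ := Finset.mem_image.1 hc'
      simp only [hball, Finset.mem_filter, Finset.mem_univ, true_and] at hi
      exact hi
    · intro c hc' d hd hcd
      obtain ⟨a, -, rfl⟩ := Finset.mem_image.1 hc'
      obtain ⟨b, -, rfl⟩ := Finset.mem_image.1 hd
      exact hsep a b fun hab => hcd (by rw [hab])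
  calc (SL.card : ℝ)
      ≤ ((SB.biUnion ball).card : ℝ) := by exact_mod_cast Finset.card_le_card hsub
    _ ≤ ∑ j ∈ SB, ((ball j).card : ℝ) := by exact_mod_cast Finset.card_biUnion_le
    _ ≤ ∑ j ∈ SB, (2 * (R) / δ + 1) ^ 3 := Finset.sum_le_sum fun j _ => hballcard j
    _ = (2 * (R) / δ + 1) ^ 3 * SB.card := by
        rw [Finset.sum_const, nsmul_eq_mul, mul_comm]

end RdvSplitRadius

open RdvSplit RdvSplitRadius in
/-- **The split glue at a general locality radius `R ≥ 0`** (`RadialDefectsVanish_of_subs` is the case `R = 7/2`):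
`TwelveWithinOne → ThickThirteen → GapBeyondTwelveAt R → RadialDefectsVanish` at the selected scale `a = 50/51`, where
`GapBeyondTwelveAt R` is the third child with "every site within `R` of `x_i`" in place of "within `7/2`" — the
locality radius is NOT load-bearing in the glue (only the constant `(2R/δ₀ + 1)³` changes), so the planners may file the
third child at any `R ≥ 0` (larger `R` = weaker child: fewer sites are locally twelve).  Proof verbatim, `7/2 ↦ R`.
[folklore] -/
theorem RadialDefectsVanish_of_subs_at {R : ℝ} (hR : 0 ≤ R)
    (hK2 : ∀ x : (N : ℕ) → (Fin N → EuclideanSpace ℝ (Fin 3)),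
      (∀ N, Literature.MathematicalPhysics.StatisticalMechanics.IsGroundState
        Literature.MathematicalPhysics.StatisticalMechanics.lennardJones (x N)) →
      Filter.Tendsto (fun N : ℕ => (Nat.card {i : Fin N // ¬ ((∀ j : Fin N, dist (x N i) (x N j) ≤ 11 / 10 →
        ∀ k : Fin N, k ≠ j → (55 : ℝ) / 57 ≤ dist (x N j) (x N k)) ∧
        12 ≤ (Finset.univ.filter fun j : Fin N => j ≠ i ∧ dist (x N i) (x N j) ≤ 1).card)} : ℝ) / N)
        Filter.atTop (nhds 0))
    (hT : ∀ T : Finset (EuclideanSpace ℝ (Fin 3)), (∀ v ∈ T, (55 : ℝ) / 57 ≤ ‖v‖ ∧ ‖v‖ ≤ 1) →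
      (∀ v ∈ T, ∀ w ∈ T, v ≠ w → (55 : ℝ) / 57 ≤ dist v w) → T.card ≤ 12)
    (hG : ∀ x : (N : ℕ) → (Fin N → EuclideanSpace ℝ (Fin 3)),
      (∀ N, Literature.MathematicalPhysics.StatisticalMechanics.IsGroundState
        Literature.MathematicalPhysics.StatisticalMechanics.lennardJones (x N)) →
      ∀ θ : ℝ, 0 < θ → ∃ᶠ N in Filter.atTop, (Nat.card {i : Fin N //
        (∀ j : Fin N, dist (x N i) (x N j) ≤ R →
          (∀ k : Fin N, dist (x N j) (x N k) ≤ 11 / 10 → ∀ l : Fin N, l ≠ k → (55 : ℝ) / 57 ≤ dist (x N k) (x N l)) ∧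
          (Finset.univ.filter fun k : Fin N => k ≠ j ∧ dist (x N j) (x N k) ≤ 1).card = 12) ∧
        ∃ j : Fin N, j ≠ i ∧ 1 < dist (x N i) (x N j) ∧ dist (x N i) (x N j) < 21 / 17} : ℝ) ≤ θ * N) :
    Summit.AtomisticToContinuum.Crystallization.Theses.GappedShellCensus.RadialDefectsVanish := by
  intro x hx
  refine ⟨50 / 51, by norm_num, by norm_num, fun θ hθ => ?_⟩
  obtain ⟨δ₀, hδ₀, hsep⟩ := LennardJonesMinimalDistance_holds
  set K : ℝ := (2 * R / δ₀ + 1) ^ 3 with hK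
  have hK1 : 1 ≤ K := by
    have h0 : (0 : ℝ) ≤ 2 * R / δ₀ := by positivity
    have h1 : (1 : ℝ) ≤ 2 * R / δ₀ + 1 := by linarith
    exact one_le_pow₀ h1
  have hKpos : 0 < K := by linarith
  -- (1) eventually few non-PRE sites (child `TwelveWithinOne`)
  have h1 : ∀ᶠ N in Filter.atTop,
      ((Finset.univ.filter fun i : Fin N => ¬ ((∀ j : Fin N, dist (x N i) (x N j) ≤ 11 / 10 →
        ∀ k : Fin N, k ≠ j → (55 : ℝ) / 57 ≤ dist (x N j) (x N k)) ∧
        12 ≤ (Finset.univ.filter fun j : Fin N => j ≠ i ∧ dist (x N i) (x N j) ≤ 1).card)).card : ℝ) ≤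
        θ / (2 * K) * N := by
    have hpos : (0 : ℝ) < θ / (2 * K) := by positivity
    filter_upwards [(hK2 x hx).eventually (gt_mem_nhds hpos)] with N hN
    rw [Nat.card_eq_fintype_card, Fintype.card_subtype] at hN
    rcases Nat.eq_zero_or_pos N with hN0 | hNpos
    · subst hN0
      simp
    · have hNr : (0 : ℝ) < N := by exact_mod_cast hNpos
      exact ((div_lt_iff₀ hNr).1 hN).le
  -- (2) frequently few locally-twelve sites with an annulus neighbour (child `GapBeyondTwelve`)
  have h2 : ∃ᶠ N in Filter.atTop,
      ((Finset.univ.filter fun i : Fin N =>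
        (∀ j : Fin N, dist (x N i) (x N j) ≤ R →
          (∀ k : Fin N, dist (x N j) (x N k) ≤ 11 / 10 → ∀ l : Fin N, l ≠ k → (55 : ℝ) / 57 ≤ dist (x N k) (x N l)) ∧
          (Finset.univ.filter fun k : Fin N => k ≠ j ∧ dist (x N j) (x N k) ≤ 1).card = 12) ∧
        ∃ j : Fin N, j ≠ i ∧ 1 < dist (x N i) (x N j) ∧ dist (x N i) (x N j) < 21 / 17).card : ℝ) ≤
        θ / 2 * N := by
    refine (hG x hx (θ / 2) (by positivity)).mono fun N hN => ?_
    rw [Nat.card_eq_fintype_card, Fintype.card_subtype] at hN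
    exact hN
  -- (3) combine at a fixed (frequent) `N`
  refine (h2.and_eventually h1).mono ?_
  rintro N ⟨hA, hP⟩
  rw [Nat.card_eq_fintype_card, Fintype.card_subtype]
  have hsepN : ∀ i j : Fin N, i ≠ j → δ₀ ≤ dist (x N i) (x N j) := hsep N (x N) (hx N)
  -- the finsets of this `N`
  set SGT := Finset.univ.filter fun i : Fin N => ¬ ((Finset.univ.filter fun j : Fin N =>
      j ≠ i ∧ dist (x N i) (x N j) ≤ 50 / 51 * (1 + 1 / 50)).card = 12 ∧
      ∀ j : Fin N, j ≠ i → 50 / 51 * (1 - 1 / 50) ≤ dist (x N i) (x N j) ∧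
        (dist (x N i) (x N j) ≤ 50 / 51 * (1 + 1 / 50) ∨ 50 / 51 * (63 / 50) ≤ dist (x N i) (x N j))) with hSGT
  set SA := Finset.univ.filter fun i : Fin N =>
      (∀ j : Fin N, dist (x N i) (x N j) ≤ R →
        (∀ k : Fin N, dist (x N j) (x N k) ≤ 11 / 10 → ∀ l : Fin N, l ≠ k → (55 : ℝ) / 57 ≤ dist (x N k) (x N l)) ∧
        (Finset.univ.filter fun k : Fin N => k ≠ j ∧ dist (x N j) (x N k) ≤ 1).card = 12) ∧
      ∃ j : Fin N, j ≠ i ∧ 1 < dist (x N i) (x N j) ∧ dist (x N i) (x N j) < 21 / 17 with hSA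
  set SP := Finset.univ.filter fun i : Fin N => ¬ ((∀ j : Fin N, dist (x N i) (x N j) ≤ 11 / 10 →
      ∀ k : Fin N, k ≠ j → (55 : ℝ) / 57 ≤ dist (x N j) (x N k)) ∧
      12 ≤ (Finset.univ.filter fun j : Fin N => j ≠ i ∧ dist (x N i) (x N j) ≤ 1).card) with hSP
  set SL := Finset.univ.filter fun i : Fin N => ¬ ∀ j : Fin N, dist (x N i) (x N j) ≤ R →
      ((∀ k : Fin N, dist (x N j) (x N k) ≤ 11 / 10 → ∀ l : Fin N, l ≠ k → (55 : ℝ) / 57 ≤ dist (x N k) (x N l)) ∧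
        (Finset.univ.filter fun k : Fin N => k ≠ j ∧ dist (x N j) (x N k) ≤ 1).card = 12) with hSL
  set SB := Finset.univ.filter fun j : Fin N => ¬ ((∀ k : Fin N, dist (x N j) (x N k) ≤ 11 / 10 →
      ∀ l : Fin N, l ≠ k → (55 : ℝ) / 57 ≤ dist (x N k) (x N l)) ∧
      (Finset.univ.filter fun k : Fin N => k ≠ j ∧ dist (x N j) (x N k) ≤ 1).card = 12) with hSB
  -- (a) not gapped-twelve ⇒ not locally twelve, or locally twelve with an annulus neighbour
  have hGT : (SGT.card : ℝ) ≤ SL.card + SA.card := by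
    have hsub : SGT ⊆ SL ∪ SA := by
      intro i hi
      rw [hSGT, Finset.mem_filter] at hi
      rw [Finset.mem_union, hSL, hSA, Finset.mem_filter, Finset.mem_filter]
      by_cases hL : ∀ j : Fin N, dist (x N i) (x N j) ≤ R →
          ((∀ k : Fin N, dist (x N j) (x N k) ≤ 11 / 10 → ∀ l : Fin N, l ≠ k → (55 : ℝ) / 57 ≤ dist (x N k) (x N l)) ∧
            (Finset.univ.filter fun k : Fin N => k ≠ j ∧ dist (x N j) (x N k) ≤ 1).card = 12)
      · right
        refine ⟨Finset.mem_univ _, hL, ?_⟩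
        by_contra hAnn
        have hGi := hL i (by rw [dist_self]; exact hR)
        exact hi.2 (gappedTwelve_of_twelve (x N) hGi.1 hGi.2 hAnn)
      · left
        exact ⟨Finset.mem_univ _, hL⟩
    exact_mod_cast (Finset.card_le_card hsub).trans (Finset.card_union_le _ _)
  -- (b) spoiled sites are few: packing count around the non-twelve sites
  have hLoc : (SL.card : ℝ) ≤ K * SB.card := by
    refine card_le_mul_card_of_local_at hR (x N)
      (fun j : Fin N => (∀ k : Fin N, dist (x N j) (x N k) ≤ 11 / 10 →
          ∀ l : Fin N, l ≠ k → (55 : ℝ) / 57 ≤ dist (x N k) (x N l)) ∧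
        (Finset.univ.filter fun k : Fin N => k ≠ j ∧ dist (x N j) (x N k) ≤ 1).card = 12)
      hδ₀ hsepN SL SB (fun i hi => ?_) (fun j hj => ?_)
    · rw [hSL, Finset.mem_filter] at hi
      exact hi.2
    · rw [hSB, Finset.mem_filter]
      exact ⟨Finset.mem_univ _, hj⟩
  -- (c) non-twelve sites are non-PRE sites (thick thirteen)
  have hGood : (SB.card : ℝ) ≤ SP.card := by
    have hsub : SB ⊆ SP := by
      intro j hj
      rw [hSB, Finset.mem_filter] at hj
      rw [hSP, Finset.mem_filter]
      refine ⟨Finset.mem_univ _, fun hp => hj.2 ⟨hp.1, ?_⟩⟩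
      exact le_antisymm (card_bond_le_twelve hT (x N) hp.1) hp.2
    exact_mod_cast Finset.card_le_card hsub
  have hKθ : K * (θ / (2 * K) * N) = θ / 2 * N := by
    field_simp
  calc (SGT.card : ℝ) ≤ SL.card + SA.card := hGT
    _ ≤ K * SB.card + θ / 2 * N := add_le_add hLoc hA
    _ ≤ K * SP.card + θ / 2 * N := by gcongr
    _ ≤ K * (θ / (2 * K) * N) + θ / 2 * N := by gcongr
    _ = θ * N := by rw [hKθ]; ring

open RdvSplit in
/-- **The crux from the Tammes-13 named fact and the two energetic children, general locality radius `R ≥ 0`**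
(`radialDefectsVanish_of_tammes` is the case `R = 7/2`). [cite: MusinTarasov2012, Theorem 1] -/
theorem radialDefectsVanish_of_tammes_at {R : ℝ} (hR : 0 ≤ R) (hMT : musinTarasov2012_tammes_thirteen)
    (hK2 : ∀ x : (N : ℕ) → (Fin N → EuclideanSpace ℝ (Fin 3)),
      (∀ N, Literature.MathematicalPhysics.StatisticalMechanics.IsGroundState
        Literature.MathematicalPhysics.StatisticalMechanics.lennardJones (x N)) →
      Filter.Tendsto (fun N : ℕ => (Nat.card {i : Fin N // ¬ ((∀ j : Fin N, dist (x N i) (x N j) ≤ 11 / 10 →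
        ∀ k : Fin N, k ≠ j → (55 : ℝ) / 57 ≤ dist (x N j) (x N k)) ∧
        12 ≤ (Finset.univ.filter fun j : Fin N => j ≠ i ∧ dist (x N i) (x N j) ≤ 1).card)} : ℝ) / N)
        Filter.atTop (nhds 0))
    (hG : ∀ x : (N : ℕ) → (Fin N → EuclideanSpace ℝ (Fin 3)),
      (∀ N, Literature.MathematicalPhysics.StatisticalMechanics.IsGroundState
        Literature.MathematicalPhysics.StatisticalMechanics.lennardJones (x N)) →
      ∀ θ : ℝ, 0 < θ → ∃ᶠ N in Filter.atTop, (Nat.card {i : Fin N //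
        (∀ j : Fin N, dist (x N i) (x N j) ≤ R →
          (∀ k : Fin N, dist (x N j) (x N k) ≤ 11 / 10 → ∀ l : Fin N, l ≠ k → (55 : ℝ) / 57 ≤ dist (x N k) (x N l)) ∧
          (Finset.univ.filter fun k : Fin N => k ≠ j ∧ dist (x N j) (x N k) ≤ 1).card = 12) ∧
        ∃ j : Fin N, j ≠ i ∧ 1 < dist (x N i) (x N j) ∧ dist (x N i) (x N j) < 21 / 17} : ℝ) ≤ θ * N) :
    Summit.AtomisticToContinuum.Crystallization.Theses.GappedShellCensus.RadialDefectsVanish :=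
  RadialDefectsVanish_of_subs_at hR hK2 (stub_thickThirteen_of_tammes hMT) hG

/-- **Locality radius `0`** — the weakest third child the glue accepts (only the site itself must be a separated
exactly-twelve site with an annulus neighbour): `fact → TwelveWithinOne → GapBeyondTwelveAt 0 → RadialDefectsVanish`.
[cite: MusinTarasov2012, Theorem 1] -/
theorem radialDefectsVanish_of_tammes_at_zero (hMT : musinTarasov2012_tammes_thirteen)
    (hK2 : ∀ x : (N : ℕ) → (Fin N → EuclideanSpace ℝ (Fin 3)),
      (∀ N, Literature.MathematicalPhysics.StatisticalMechanics.IsGroundState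
        Literature.MathematicalPhysics.StatisticalMechanics.lennardJones (x N)) →
      Filter.Tendsto (fun N : ℕ => (Nat.card {i : Fin N // ¬ ((∀ j : Fin N, dist (x N i) (x N j) ≤ 11 / 10 →
        ∀ k : Fin N, k ≠ j → (55 : ℝ) / 57 ≤ dist (x N j) (x N k)) ∧
        12 ≤ (Finset.univ.filter fun j : Fin N => j ≠ i ∧ dist (x N i) (x N j) ≤ 1).card)} : ℝ) / N)
        Filter.atTop (nhds 0))
    (hG : ∀ x : (N : ℕ) → (Fin N → EuclideanSpace ℝ (Fin 3)),
      (∀ N, Literature.MathematicalPhysics.StatisticalMechanics.IsGroundState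
        Literature.MathematicalPhysics.StatisticalMechanics.lennardJones (x N)) →
      ∀ θ : ℝ, 0 < θ → ∃ᶠ N in Filter.atTop, (Nat.card {i : Fin N //
        (∀ j : Fin N, dist (x N i) (x N j) ≤ 0 →
          (∀ k : Fin N, dist (x N j) (x N k) ≤ 11 / 10 → ∀ l : Fin N, l ≠ k → (55 : ℝ) / 57 ≤ dist (x N k) (x N l)) ∧
          (Finset.univ.filter fun k : Fin N => k ≠ j ∧ dist (x N j) (x N k) ≤ 1).card = 12) ∧
        ∃ j : Fin N, j ≠ i ∧ 1 < dist (x N i) (x N j) ∧ dist (x N i) (x N j) < 21 / 17} : ℝ) ≤ θ * N) :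
    Summit.AtomisticToContinuum.Crystallization.Theses.GappedShellCensus.RadialDefectsVanish :=
  radialDefectsVanish_of_tammes_at le_rfl hMT hK2 hG

end Summit.AtomisticToContinuum.Crystallization.Theorems

end
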